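import Mathlib
import Literature.Analysis.FluidPDE.TypeIICoreWitness
import Literature.Analysis.FluidPDE.ClassicalSolution
import Literature.Analysis.FluidPDE.EulerTimeScaling
import Literature.Analysis.FluidPDE.KNSSThm53OfWindow
import Summits.NavierStokesRegularity.NavierStokesRegularity.Theorems.TypeIIInviscidRelaxationCoreExclusionAnchorReduction
import Summits.NavierStokesRegularity.NavierStokesRegularity.Theorems.TypeIIInviscidRelaxationMonopoleCoreExclusionWitnessInflation
import HarnessLib

/-!
# Crux `MonopoleCoreExclusion` (stmt-NavierStokesRegularity-1965): exactly axisymmetric blow-ups carry COVERING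
# axisymmetric witnesses at every level — non-vacuity of the covering hypothesis, and the anchor stub on the Hou class

`--supports stmt-NavierStokesRegularity-1965` (helper file; theorems only, no definitions, no `sorry`; outside the
import cone of the route file).  Companion of `…MonopoleCoreExclusionWitnessInflation` (p835367), which proves the
registered anchor stub `stub_anchoredLateAxisymWitness` of line `axisymmetric_comparison_flow` for COVERING
axisymmetric witnesses (slice slow, `‖u t x‖ ≤ V/K`, outside the witness ball).

* `coveringAxisymWitnesses_of_isAxisymmetric` — the route's informal claim "an exactly axisymmetric blow-up is
  trivially witnessed in the axisymmetric class (`Q = id`, `W` = normalised `u`, error `0`)" made a kernel theorem,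
  in the covering form: a maximal smooth solution on `[0,T)`, Leray–Hopf from a rapidly decaying datum, whose slices
  are axisymmetric, carries at every level `K > 0`, after every `t₀ < T`, a COVERING level-`K` axisymmetric core
  witness.  Construction at a time `t` late enough that Leray's rate (`exists_leray_const_of_speedBound`) forces the
  speed maximum `V = ‖u(t,x₁)‖` (attained on a ball `‖x‖ ≤ R'` beyond the far-field radius,
  `exists_farField_norm_le`) above `max K 4 · max M 1` (`M` the far-field bound): centre `x₀` = axis projection of
  `x₁`, core length `L = max (2R'+1) ((R+R')/K) (Kν/V)`, frame `Q = id`, profile `W y = V⁻¹ u(t, x₀ + L y)`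
  truncated at `‖y‖ ≤ max K 1` (axisymmetric because `x₀` lies on the axis); closeness error `0`; oscillation from
  `x₁` (profile size `1`) against the far point `x₀ + L e_z` (size `≤ 1/4`); covering because `K·L ≥ R + R'` puts
  the complement of the witness ball in the far field, where `‖u‖ ≤ M ≤ V/K`.
* `anchoredLateAxisymWitness_of_isAxisymmetric` — hence the conclusion of `stub_anchoredLateAxisymWitness` holds
  VERBATIM for every exactly axisymmetric maximal solution (by `anchoredLateAxisymWitness_of_coveringWitnesses`):
  on the Hou class the [L] anchor stub is a theorem, with no rate hypothesis.
* `noAxisymBlowup_of_transfer_of_shadowing` — and the two OTHER stubs of the line (the landed transfer's conclusion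
  `hComp` and the registered `stub_axisymShadowing`, both verbatim as hypotheses) already exclude every exactly
  axisymmetric blow-up in the standing class (`monopoleCoreExclusion_covering_of_shadowing`): restricted to
  axisymmetric data the line needs no anchor stub at all.

Nothing about Navier–Stokes regularity is claimed; no stub or crux is proved here.
-/

noncomputable section

open Set Metric MeasureTheory Function Filter Topology
open Literature.Analysis Literature.Analysis.FluidPDE

namespace Summit.NavierStokesRegularity.NavierStokesRegularity.Theorems

-- the problem directory repeats the summit name (`NavierStokesRegularity/NavierStokesRegularity`)
set_option linter.dupNamespace false

namespace MonopoleWitnessInflation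

open CoreExclusionAnchor

/-- **Exactly axisymmetric blow-ups carry covering axisymmetric witnesses at every level.**  Let `(u, p)` be a
maximal smooth solution on `[0,T)` (`ν, T > 0`), Leray–Hopf from its rapidly decaying datum, with axisymmetric
slices `u t`, `t ∈ [0,T)`.  Then for every `K > 0` and every `t₀ < T` there is a time `t₀ < t < T` at which `u t`
carries a level-`K` axisymmetric core witness `(x₀, L, V, Q, W)` — speed bound `V` attained within `L` of `x₀` up
to the factor `2`, profile oscillation `≥ 1/4` on the unit ball, `Kν ≤ LV`, `K⁻¹`-closeness on `‖y‖ ≤ K` — which is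
COVERING: `‖u t x‖ ≤ V/K` whenever `dist x x₀ > K·L`.  (Leray's rate, far-field bound, maximum of the continuous
slice on a large ball; `Q = id`, `W` = truncated normalised slice about the axis point below the maximum.) [folklore] -/
theorem coveringAxisymWitnesses_of_isAxisymmetric {ν T : ℝ}
    {u : ℝ → EuclideanSpace ℝ (Fin 3) → EuclideanSpace ℝ (Fin 3)}
    {p : ℝ → EuclideanSpace ℝ (Fin 3) → ℝ}
    (hν : 0 < ν) (hT : 0 < T) (hmax : IsMaximalSmoothSolution ν 0 u p T)
    (hLH : IsLerayHopfOn T ν 0 (u 0) u) (hdec : HasRapidSpatialDecay (u 0))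
    (hax : ∀ t ∈ Ico 0 T, IsAxisymmetric (u t)) :
    ∀ K : ℝ, 0 < K → ∀ t₀ < T, ∃ t, t₀ < t ∧ t < T ∧
      ∃ (x₀ : EuclideanSpace ℝ (Fin 3)) (L V : ℝ)
        (Q : EuclideanSpace ℝ (Fin 3) ≃ₗᵢ[ℝ] EuclideanSpace ℝ (Fin 3))
        (W : EuclideanSpace ℝ (Fin 3) → EuclideanSpace ℝ (Fin 3)),
        0 < L ∧ 0 < V ∧ IsAxisymmetric W ∧ (∀ x, ‖u t x‖ ≤ V) ∧
        (∃ x₁, dist x₁ x₀ ≤ L ∧ V ≤ 2 * ‖u t x₁‖) ∧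
        (∃ y y' : EuclideanSpace ℝ (Fin 3), ‖y‖ ≤ 1 ∧ ‖y'‖ ≤ 1 ∧ (4 : ℝ)⁻¹ ≤ ‖W y - W y'‖) ∧
        K * ν ≤ L * V ∧
        (∀ y : EuclideanSpace ℝ (Fin 3), ‖y‖ ≤ K →
          ‖V⁻¹ • Q.symm (u t (x₀ + L • Q y)) - W y‖ ≤ K⁻¹) ∧
        (∀ x : EuclideanSpace ℝ (Fin 3), K * L < dist x x₀ → ‖u t x‖ ≤ V / K) := by
  intro K hK t₀ ht₀
  obtain ⟨c₀, hc₀, hleray⟩ := exists_leray_const_of_speedBound hν hT hmax hLH hdec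
  obtain ⟨δ, R, M, hδ, hfar⟩ := exists_farField_norm_le hν hT hmax.1 hLH hdec
  /- ### constants -/
  set M' : ℝ := max M 1 with hM'_def
  have hMM' : M ≤ M' := le_max_left _ _
  have hM'1 : 1 ≤ M' := le_max_right _ _
  have hM'0 : 0 < M' := one_pos.trans_le hM'1
  set A : ℝ := max K 4 * M' with hA_def
  have hA0 : 0 < A := mul_pos (lt_of_lt_of_le four_pos (le_max_right _ _)) hM'0
  have hA4 : 4 * M' ≤ A := mul_le_mul_of_nonneg_right (le_max_right _ _) hM'0.le
  have hAK : K * M' ≤ A := mul_le_mul_of_nonneg_right (le_max_left _ _) hM'0.le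
  have hMA : M < A := by nlinarith
  /- ### the time -/
  set t₁ : ℝ := max (max t₀ (T / 2)) (max (T - δ) (T - c₀ ^ 2 * ν / A ^ 2)) with ht₁_def
  have hεpos : 0 < c₀ ^ 2 * ν / A ^ 2 := by positivity
  have ht₁T : t₁ < T :=
    max_lt (max_lt ht₀ (by linarith)) (max_lt (by linarith) (by linarith))
  set t : ℝ := (t₁ + T) / 2 with ht_def
  have ht₁t : t₁ < t := by rw [ht_def]; linarith
  have htT : t < T := by rw [ht_def]; linarith
  have ht₀t : t₀ < t := lt_of_le_of_lt ((le_max_left _ _).trans (le_max_left _ _)) ht₁t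
  have ht0 : 0 < t := by
    have h1 : T / 2 ≤ t₁ := (le_max_right _ _).trans (le_max_left _ _)
    linarith
  have htfar : T - δ < t := lt_of_le_of_lt ((le_max_left _ _).trans (le_max_right _ _)) ht₁t
  have htler : T - t < c₀ ^ 2 * ν / A ^ 2 := by
    have h1 : T - c₀ ^ 2 * ν / A ^ 2 ≤ t₁ := (le_max_right _ _).trans (le_max_right _ _)
    linarith
  have htI : t ∈ Ico 0 T := ⟨ht0.le, htT⟩
  /- ### the speed maximum at time `t` -/
  set R' : ℝ := max R 0 + 1 with hR'_def
  have hRR' : R < R' := by have := le_max_left R 0; rw [hR'_def]; linarith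
  have hR'1 : 1 ≤ R' := by have := le_max_right R 0; rw [hR'_def]; linarith
  have hR'0 : 0 < R' := one_pos.trans_le hR'1
  have hcont : Continuous (u t) := (hmax.1.smooth_velocity.contDiff_slice htI).continuous
  obtain ⟨x₁, hx₁B, hmax₁⟩ :=
    (isCompact_closedBall (0 : EuclideanSpace ℝ (Fin 3)) R').exists_isMaxOn
      ⟨0, mem_closedBall_self hR'0.le⟩ hcont.norm.continuousOn
  rw [mem_closedBall, dist_zero_right] at hx₁B
  set V : ℝ := ‖u t x₁‖ with hV_def
  have hV0' : 0 ≤ V := norm_nonneg _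
  have hfar_t : ∀ x : EuclideanSpace ℝ (Fin 3), R < ‖x‖ → ‖u t x‖ ≤ M :=
    fun x hx => hfar t htfar ht0 htT x hx
  have hbd0 : ∀ x, ‖u t x‖ ≤ max V M := fun x => by
    by_cases hx : ‖x‖ ≤ R'
    · have hxB : x ∈ closedBall (0 : EuclideanSpace ℝ (Fin 3)) R' := by
        rw [mem_closedBall, dist_zero_right]; exact hx
      exact (hmax₁ hxB).trans (le_max_left _ _)
    · push Not at hx
      exact (hfar_t x (hRR'.trans hx)).trans (le_max_right _ _)
  -- Leray: `max V M ≥ A`, hence `V ≥ A`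
  have hAle : A ≤ max V M := by
    have h1 := hleray t htI (max V M) hbd0
    have hTt : 0 < T - t := sub_pos.2 htT
    have hsq : Real.sqrt (T - t) < c₀ * Real.sqrt ν / A := by
      have h2 : T - t < (c₀ * Real.sqrt ν / A) ^ 2 := by
        rw [div_pow, mul_pow, Real.sq_sqrt hν.le]; exact htler
      calc Real.sqrt (T - t) < Real.sqrt ((c₀ * Real.sqrt ν / A) ^ 2) :=
            Real.sqrt_lt_sqrt hTt.le h2
        _ = c₀ * Real.sqrt ν / A := Real.sqrt_sq (by positivity)
    have hpos : 0 < Real.sqrt (T - t) := Real.sqrt_pos.2 hTt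
    have hnum : 0 < c₀ * Real.sqrt ν := mul_pos hc₀ (Real.sqrt_pos.2 hν)
    have h3 : A < c₀ * Real.sqrt ν / Real.sqrt (T - t) := by
      rw [lt_div_iff₀ hpos]
      calc A * Real.sqrt (T - t) < A * (c₀ * Real.sqrt ν / A) := mul_lt_mul_of_pos_left hsq hA0
        _ = c₀ * Real.sqrt ν := by field_simp
    exact (h3.le.trans h1)
  have hVA : A ≤ V := by
    rcases le_max_iff.1 hAle with h | h
    · exact h
    · exact absurd h (not_le.2 hMA)
  have hV0 : 0 < V := hA0.trans_le hVA
  have hMV : M ≤ V := hMA.le.trans hVA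
  have hbd : ∀ x, ‖u t x‖ ≤ V := fun x => (hbd0 x).trans (max_le le_rfl hMV)
  have h4M'V : 4 * M' ≤ V := hA4.trans hVA
  have hKM'V : K * M' ≤ V := hAK.trans hVA
  /- ### the axis point below the maximum -/
  set x₀ : EuclideanSpace ℝ (Fin 3) := (x₁ 2) • eZ with hx₀_def
  have hnorm : ∀ z : EuclideanSpace ℝ (Fin 3), ‖z‖ = Real.sqrt (z 0 ^ 2 + z 1 ^ 2 + z 2 ^ 2) := fun z => by
    rw [EuclideanSpace.norm_eq]
    congr 1
    simp [Fin.sum_univ_three, Real.norm_eq_abs, sq_abs]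
  have hx₀0 : x₀ 0 = 0 := by simp [hx₀_def, eZ]
  have hx₀1 : x₀ 1 = 0 := by simp [hx₀_def, eZ]
  have hx₀2 : x₀ 2 = x₁ 2 := by simp [hx₀_def, eZ]
  have hx₀n : ‖x₀‖ ≤ ‖x₁‖ := by
    rw [hnorm x₀, hnorm x₁, hx₀0, hx₀1, hx₀2]
    exact Real.sqrt_le_sqrt (by nlinarith [sq_nonneg (x₁ 0), sq_nonneg (x₁ 1)])
  have hd₁ : dist x₁ x₀ ≤ ‖x₁‖ := by
    rw [dist_eq_norm, hnorm (x₁ - x₀), hnorm x₁]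
    refine Real.sqrt_le_sqrt ?_
    have e0 : (x₁ - x₀) 0 = x₁ 0 := by simp [hx₀0]
    have e1 : (x₁ - x₀) 1 = x₁ 1 := by simp [hx₀1]
    have e2 : (x₁ - x₀) 2 = 0 := by simp [hx₀2]
    rw [e0, e1, e2]
    nlinarith [sq_nonneg (x₁ 2)]
  have hx₀R' : ‖x₀‖ ≤ R' := hx₀n.trans hx₁B
  have hx₁x₀R' : dist x₁ x₀ ≤ R' := hd₁.trans hx₁B
  -- rotations fix `x₀` and commute with the recentred rescaling
  have hrot_add : ∀ (θ : ℝ) (a b : EuclideanSpace ℝ (Fin 3)), rotZ θ (a + b) = rotZ θ a + rotZ θ b :=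
    fun θ a b => by
      ext i
      fin_cases i <;> simp <;> ring
  have hrot_x₀ : ∀ θ : ℝ, rotZ θ x₀ = x₀ := fun θ => by
    ext i
    fin_cases i <;> simp [hx₀_def, eZ]
  /- ### the core length, the frame, the profile -/
  set L : ℝ := max (2 * R' + 1) (max ((R + R') / K) (K * ν / V)) with hL_def
  have hL1 : 2 * R' + 1 ≤ L := le_max_left _ _
  have hL2 : (R + R') / K ≤ L := (le_max_left _ _).trans (le_max_right _ _)
  have hL3 : K * ν / V ≤ L := (le_max_right _ _).trans (le_max_right _ _)
  have hL0 : 0 < L := by linarith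
  have hR'L : R' ≤ L := by linarith
  have hKL : R + R' ≤ K * L := by
    rw [div_le_iff₀ hK] at hL2; linarith [mul_comm L K]
  set K₁ : ℝ := max K 1 with hK₁_def
  have hKK₁ : K ≤ K₁ := le_max_left _ _
  have hK₁1 : 1 ≤ K₁ := le_max_right _ _
  set W : EuclideanSpace ℝ (Fin 3) → EuclideanSpace ℝ (Fin 3) :=
    fun y => if ‖y‖ ≤ K₁ then V⁻¹ • u t (x₀ + L • y) else 0 with hW_def
  refine ⟨t, ht₀t, htT, x₀, L, V, LinearIsometryEquiv.refl ℝ (EuclideanSpace ℝ (Fin 3)), W, hL0, hV0,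
    ?_, hbd, ⟨x₁, hx₁x₀R'.trans hR'L, by linarith⟩, ?_, ?_, ?_, ?_⟩
  · -- axisymmetry of the truncated normalised slice about the axis point `x₀`
    intro θ y
    have hn : ‖rotZ θ y‖ = ‖y‖ := norm_rotZ θ y
    show (if ‖rotZ θ y‖ ≤ K₁ then V⁻¹ • u t (x₀ + L • rotZ θ y) else 0) =
      rotZ θ (if ‖y‖ ≤ K₁ then V⁻¹ • u t (x₀ + L • y) else 0)
    by_cases h : ‖y‖ ≤ K₁
    · have h' : ‖rotZ θ y‖ ≤ K₁ := by rw [hn]; exact h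
      have harg : x₀ + L • rotZ θ y = rotZ θ (x₀ + L • y) := by
        rw [hrot_add, hrot_x₀, rotZ_smul]
      rw [if_pos h', if_pos h, harg, hax t htI θ (x₀ + L • y), rotZ_smul]
    · have h' : ¬ ‖rotZ θ y‖ ≤ K₁ := by rw [hn]; exact h
      rw [if_neg h', if_neg h, rotZ_apply_zero_vec]
  · -- oscillation: the maximum point against the far point `x₀ + L e_z`
    have hy₁n : ‖L⁻¹ • (x₁ - x₀)‖ ≤ 1 := by
      rw [norm_smul, Real.norm_of_nonneg (inv_nonneg.2 hL0.le), ← dist_eq_norm]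
      calc L⁻¹ * dist x₁ x₀ ≤ L⁻¹ * L :=
            mul_le_mul_of_nonneg_left (hx₁x₀R'.trans hR'L) (inv_nonneg.2 hL0.le)
        _ = 1 := inv_mul_cancel₀ hL0.ne'
    have heZn : ‖(eZ : EuclideanSpace ℝ (Fin 3))‖ = 1 := by simp [eZ]
    have hWy₁ : W (L⁻¹ • (x₁ - x₀)) = V⁻¹ • u t x₁ := by
      have h1 : ‖L⁻¹ • (x₁ - x₀)‖ ≤ K₁ := hy₁n.trans hK₁1
      simp only [hW_def, h1, if_true, smul_smul, mul_inv_cancel₀ hL0.ne', one_smul, add_sub_cancel]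
    have hWeZ : W eZ = V⁻¹ • u t (x₀ + L • eZ) := by
      have h1 : ‖(eZ : EuclideanSpace ℝ (Fin 3))‖ ≤ K₁ := heZn.le.trans hK₁1
      simp only [hW_def, h1, if_true]
    have hn1 : ‖W (L⁻¹ • (x₁ - x₀))‖ = 1 := by
      rw [hWy₁, norm_smul, Real.norm_of_nonneg (inv_nonneg.2 hV0.le), ← hV_def, inv_mul_cancel₀ hV0.ne']
    have hfarpt : R < ‖x₀ + L • eZ‖ := by
      have h1 : ‖L • (eZ : EuclideanSpace ℝ (Fin 3))‖ = L := by
        rw [norm_smul, heZn, mul_one, Real.norm_of_nonneg hL0.le]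
      have h2 : ‖L • (eZ : EuclideanSpace ℝ (Fin 3))‖ - ‖x₀‖ ≤ ‖x₀ + L • eZ‖ := by
        have := norm_sub_norm_le (L • (eZ : EuclideanSpace ℝ (Fin 3))) (-x₀)
        rw [norm_neg, sub_neg_eq_add, add_comm] at this
        exact this
      rw [h1] at h2
      linarith
    have hn2 : ‖W eZ‖ ≤ 4⁻¹ := by
      rw [hWeZ, norm_smul, Real.norm_of_nonneg (inv_nonneg.2 hV0.le)]
      have h1 : ‖u t (x₀ + L • eZ)‖ ≤ M' := (hfar_t _ hfarpt).trans hMM'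
      rw [inv_mul_le_iff₀ hV0]
      calc ‖u t (x₀ + L • eZ)‖ ≤ M' := h1
        _ ≤ V * 4⁻¹ := by linarith
    refine ⟨L⁻¹ • (x₁ - x₀), eZ, hy₁n, heZn.le, ?_⟩
    have h := norm_sub_norm_le (W (L⁻¹ • (x₁ - x₀))) (W eZ)
    rw [hn1] at h
    linarith
  · -- Reynolds number
    rw [div_le_iff₀ hV0] at hL3
    linarith
  · -- closeness: error `0` (`Q = id`, `W` = normalised slice on `‖y‖ ≤ K ≤ max K 1`)
    intro y hy
    have h1 : ‖y‖ ≤ K₁ := hy.trans hKK₁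
    have hWy : W y = V⁻¹ • u t (x₀ + L • y) := by simp only [hW_def, h1, if_true]
    have hQ : ∀ z, (LinearIsometryEquiv.refl ℝ (EuclideanSpace ℝ (Fin 3))) z = z := fun z => rfl
    have hQs : ∀ z, (LinearIsometryEquiv.refl ℝ (EuclideanSpace ℝ (Fin 3))).symm z = z := fun z => rfl
    rw [hQ, hQs, hWy, sub_self, norm_zero]
    exact inv_nonneg.2 hK.le
  · -- covering: outside the witness ball is far field
    intro x hx
    have hxn : R < ‖x‖ := by
      have h1 : dist x x₀ ≤ ‖x‖ + ‖x₀‖ := by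
        rw [dist_eq_norm]; exact norm_sub_le _ _
      linarith
    have h1 : ‖u t x‖ ≤ M' := (hfar_t x hxn).trans hMM'
    rw [le_div_iff₀ hK]
    calc ‖u t x‖ * K ≤ M' * K := mul_le_mul_of_nonneg_right h1 hK.le
      _ = K * M' := mul_comm _ _
      _ ≤ V := hKM'V

/-- **The anchor stub of crux 1965 on the Hou class.**  For a maximal smooth solution on `[0,T)`, Leray–Hopf from a
rapidly decaying datum, with AXISYMMETRIC slices, the conclusion of the registered stub
`stub_anchoredLateAxisymWitness` (line `axisymmetric_comparison_flow`) holds verbatim: a singular anchor `xs` and,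
for every `K > 0`, a late level-`K` axisymmetric witness anchored at `xs` (covering witnesses:
`coveringAxisymWitnesses_of_isAxisymmetric`; inflation: `anchoredLateAxisymWitness_of_coveringWitnesses`, p835367).
No rate hypothesis is used. [folklore] -/
theorem anchoredLateAxisymWitness_of_isAxisymmetric {ν T : ℝ}
    {u : ℝ → EuclideanSpace ℝ (Fin 3) → EuclideanSpace ℝ (Fin 3)}
    {p : ℝ → EuclideanSpace ℝ (Fin 3) → ℝ}
    (hν : 0 < ν) (hT : 0 < T) (hmax : IsMaximalSmoothSolution ν 0 u p T)
    (hLH : IsLerayHopfOn T ν 0 (u 0) u) (hdec : HasRapidSpatialDecay (u 0))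
    (hax : ∀ t ∈ Ico 0 T, IsAxisymmetric (u t)) :
    ∃ xs : EuclideanSpace ℝ (Fin 3),
      (¬ ∃ ρ M : ℝ, 0 < ρ ∧ ∀ s ∈ Ioo (T - ρ ^ 2) T, ∀ x ∈ ball xs ρ, ‖u s x‖ ≤ M) ∧
      ∀ K : ℝ, 0 < K → ∃ t : ℝ, 0 < t ∧ t < T ∧
        ∃ (x₀ : EuclideanSpace ℝ (Fin 3)) (L V : ℝ)
          (Q : EuclideanSpace ℝ (Fin 3) ≃ₗᵢ[ℝ] EuclideanSpace ℝ (Fin 3))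
          (W : EuclideanSpace ℝ (Fin 3) → EuclideanSpace ℝ (Fin 3)),
          0 < L ∧ 0 < V ∧ IsAxisymmetric W ∧ (∀ x, ‖u t x‖ ≤ V) ∧
          (∃ x₁, dist x₁ x₀ ≤ L ∧ V ≤ 2 * ‖u t x₁‖) ∧
          (∃ y y' : EuclideanSpace ℝ (Fin 3), ‖y‖ ≤ 1 ∧ ‖y'‖ ≤ 1 ∧ (4 : ℝ)⁻¹ ≤ ‖W y - W y'‖) ∧
          K * ν ≤ L * V ∧
          (∀ y : EuclideanSpace ℝ (Fin 3), ‖y‖ ≤ K →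
            ‖V⁻¹ • Q.symm (u t (x₀ + L • Q y)) - W y‖ ≤ K⁻¹) ∧
          (T - t) * V ≤ K * L ∧ dist xs x₀ ≤ K * L / 4 :=
  anchoredLateAxisymWitness_of_coveringWitnesses hν hT hmax hLH hdec
    (coveringAxisymWitnesses_of_isAxisymmetric hν hT hmax hLH hdec hax)

/-- **Transfer + shadowing exclude every exactly axisymmetric blow-up** (crux `MonopoleCoreExclusion` restricted to
axisymmetric slices needs no anchor stub).  Assume the conclusion of the landed transfer stub
`AxisymComparisonFlow.stub_axisymComparisonFlowOfAX hAX` (`hComp`, verbatim) and the statement of the registered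
`stub_axisymShadowing` (`hShadow`, verbatim).  Then no maximal smooth solution on `[0,T)`, Leray–Hopf from a rapidly
decaying datum, has axisymmetric slices — i.e. the axisymmetric no-blow-up statement in the standing class of the
sibling crux `AxisymSwirlRegular` follows (`monopoleCoreExclusion_covering_of_shadowing` with the covering witnesses of
`coveringAxisymWitnesses_of_isAxisymmetric`). [folklore] -/
theorem noAxisymBlowup_of_transfer_of_shadowing
    (hComp : ∃ A : ℝ, 0 < A ∧
      ∀ (ν T t K : ℝ) (u : ℝ → EuclideanSpace ℝ (Fin 3) → EuclideanSpace ℝ (Fin 3))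
        (p : ℝ → EuclideanSpace ℝ (Fin 3) → ℝ),
        0 < ν → 0 < T → IsClassicalNSSolutionOn (Ico 0 T) ν 0 u p → IsLerayHopfOn T ν 0 (u 0) u →
        HasRapidSpatialDecay (u 0) → 0 < t → t < T → 1 ≤ K →
        ∀ (x₀ : EuclideanSpace ℝ (Fin 3)) (L V : ℝ)
          (Q : EuclideanSpace ℝ (Fin 3) ≃ₗᵢ[ℝ] EuclideanSpace ℝ (Fin 3))
          (W : EuclideanSpace ℝ (Fin 3) → EuclideanSpace ℝ (Fin 3)),
          0 < L → 0 < V → IsAxisymmetric W → (∀ x, ‖u t x‖ ≤ V) → K * ν ≤ L * V →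
          (∀ y : EuclideanSpace ℝ (Fin 3), ‖y‖ ≤ K →
            ‖V⁻¹ • Q.symm (u t (x₀ + L • Q y)) - W y‖ ≤ K⁻¹) →
          ∃ (v : ℝ → EuclideanSpace ℝ (Fin 3) → EuclideanSpace ℝ (Fin 3))
            (q : ℝ → EuclideanSpace ℝ (Fin 3) → ℝ) (Mv : ℝ),
            IsClassicalNSSolutionOn (Icc t T) ν 0 v q ∧
            (∀ s ∈ Icc t T, IsAxisymmetric (fun y : EuclideanSpace ℝ (Fin 3) => Q.symm (v s (x₀ + Q y)))) ∧
            (∀ s ∈ Icc t T, ∀ x, ‖v s x‖ ≤ Mv) ∧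
            (∀ x ∈ ball x₀ (K * L), ‖u t x - v t x‖ ≤ A * V / K))
    (hShadow : ∀ A : ℝ, 0 < A → ∃ K₀ : ℝ, 1 ≤ K₀ ∧ ∀ K : ℝ, K₀ ≤ K →
      ∀ (ν T t : ℝ) (u : ℝ → EuclideanSpace ℝ (Fin 3) → EuclideanSpace ℝ (Fin 3))
        (p : ℝ → EuclideanSpace ℝ (Fin 3) → ℝ),
        0 < ν → 0 < T → IsClassicalNSSolutionOn (Ico 0 T) ν 0 u p → IsLerayHopfOn T ν 0 (u 0) u →
        HasRapidSpatialDecay (u 0) → 0 < t → t < T →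
        ∀ (x₀ : EuclideanSpace ℝ (Fin 3)) (L V : ℝ)
          (Q : EuclideanSpace ℝ (Fin 3) ≃ₗᵢ[ℝ] EuclideanSpace ℝ (Fin 3)),
          0 < L → 0 < V → (∀ x, ‖u t x‖ ≤ V) →
          (∃ x₁, dist x₁ x₀ ≤ L ∧ V ≤ 2 * ‖u t x₁‖) → K * ν ≤ L * V → (T - t) * V ≤ K * L →
          ∀ (v : ℝ → EuclideanSpace ℝ (Fin 3) → EuclideanSpace ℝ (Fin 3))
            (q : ℝ → EuclideanSpace ℝ (Fin 3) → ℝ) (Mv : ℝ),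
            IsClassicalNSSolutionOn (Icc t T) ν 0 v q →
            (∀ s ∈ Icc t T, IsAxisymmetric (fun y : EuclideanSpace ℝ (Fin 3) => Q.symm (v s (x₀ + Q y)))) →
            (∀ s ∈ Icc t T, ∀ x, ‖v s x‖ ≤ Mv) →
            (∀ x ∈ ball x₀ (K * L), ‖u t x - v t x‖ ≤ A * V / K) →
            ∃ M : ℝ, ∀ s ∈ Ico t T, ∀ x ∈ ball x₀ (K * L / 2), ‖u s x‖ ≤ M) :
    ∀ (ν T : ℝ), 0 < ν → 0 < T →
      ∀ (u : ℝ → EuclideanSpace ℝ (Fin 3) → EuclideanSpace ℝ (Fin 3)) (p : ℝ → EuclideanSpace ℝ (Fin 3) → ℝ),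
      IsMaximalSmoothSolution ν 0 u p T → IsLerayHopfOn T ν 0 (u 0) u → HasRapidSpatialDecay (u 0) →
      (∀ t ∈ Ico 0 T, IsAxisymmetric (u t)) → False :=
  fun _ν _T hν hT _u _p hmax hLH hdec hax =>
    monopoleCoreExclusion_covering_of_shadowing hComp hShadow hν hT hmax hLH hdec
      (coveringAxisymWitnesses_of_isAxisymmetric hν hT hmax hLH hdec hax)

end MonopoleWitnessInflation

end Summit.NavierStokesRegularity.NavierStokesRegularity.Theorems

end
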